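import Summits.QuantumFields.YangMills.Theorems.LuscherReductionDressedRitzOfOperatorPlateau
import Summits.QuantumFields.YangMills.Theorems.FemtoTransferGapSlabFlowLift
import Summits.QuantumFields.YangMills.Theorems.FemtoTransferGapGroundState
import Summits.QuantumFields.YangMills.Theorems.FemtoTransferGapEigenbasis
import HarnessLib

/-!
# Line «polyakovlift» on crux `DressedRitz` (stmt-QuantumFields-20205), stub S-STAT `stub_liftStatics` — PREPARATION (fixed lattice):
# raw vacua vanish nowhere; transfer images, eigen-ratios and flowed Polyakov lifts are continuous; the (flowed) Polyakov triple is onto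

Fleet-service module of seat ym-infvol-p1 g5 (route `LuscherReduction`, femto rung R2b1), registered line «polyakovlift» on the crux child
`DressedRitz` (skeleton sha16 `9b069c059f21b79f`, owner ym-beyond-p1 g21; objects re-homed in `…DressedRitzPolyakovLiftDefs.lean`).  Three
fixed-lattice facts used by the companion `…PolyakovLiftStaticsPositivity.lean` to prove clause (o0) of the stub S-STAT for EVERY lift basis:

* §1 `rawVacuum_eq_smul_of_gap`, `exists_pos_le_abs_rawVacuum`, `rawVacuum_ne_zero` — a raw vacuum (`IsPhys φ`, `‖φ‖² = 1`, `K_β φ = λ₀ φ`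
  POINTWISE) is a non-zero multiple of the Perron–Frobenius ground state `Ω ≥ c > 0` of `PhysL2.exists_groundState` (Jentzsch's gap `θ < λ₀`
  on `Ω^⊥` kills the orthogonal part in `L²`; the pointwise eigen-equation upgrades "a.e." to "everywhere"), hence vanishes NOWHERE — every
  `L ≥ 1`, every real `β`;
* §2 `continuous_transferApply` (`K_β f` is continuous for physical `f`, via the tree's `continuous_transferApply_coe`), `continuous_of_eigen`,
  `continuous_eigenRatio` (`g = (g·ω)/ω`), `continuous_flowLiftAt` (`continuous_wilsonFlow`, `continuous_polyakovSite`), `continuous_ins`;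
* §3 `polyakovSite_surjective` (put `V_k` on the link `(x₀,k)`, `1` elsewhere), `flowedPolyakovSite_surjective` (the Wilson flow is invertible,
  `wilsonFlow_neg_wilsonFlow`).

HONEST FRAMING: fixed-lattice functional analysis and lattice combinatorics; no renormalisation-group content; nothing here bears on infinite
volume, the continuum limit or the Clay mass gap.  References: Reed–Simon IV [cite: ReedSimonIV1978, Thm XIII.43–44]; M. Lüscher, JHEP 08
(2010) 071 [cite: Luscher2010, §2].
-/

set_option autoImplicit false

noncomputable section

open MeasureTheory Filter Topology Real
open Literature.MathematicalPhysics.QuantumFieldTheory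
open Literature.MathematicalPhysics.QuantumFieldTheory.WilsonFlow
open Literature.MathematicalPhysics.QuantumLattice
open scoped BigOperators

namespace Summit.QuantumFields.YangMills.Theorems.FemtoTransferGap.PolyakovLift

open Summit.QuantumFields.YangMills.Theorems.FemtoTransferGap
open Summit.QuantumFields.YangMills.Theorems.FemtoTransferGap.PhysL2

/-! ## §1 Raw vacua are non-zero multiples of the Perron–Frobenius ground state -/

section RawVacuum

variable {L : ℕ} [NeZero L]

/-- `‖ψ‖² = 0` for a physical `ψ` forces `ψ = 0` almost everywhere. [folklore] -/
theorem ae_eq_zero_of_l2_self_eq_zero {ψ : GaugeConfig 3 L SU2 → ℝ} (hψ : IsPhys ψ) (h0 : l2 ψ ψ = 0) :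
    ψ =ᵐ[configMeasure SU2 L] 0 := by
  have hnn : 0 ≤ᵐ[configMeasure SU2 L] fun U => ψ U * ψ U := ae_of_all _ fun U => mul_self_nonneg _
  have hint : Integrable (fun U => ψ U * ψ U) (configMeasure SU2 L) := hψ.integrable_mul hψ
  have h := (integral_eq_zero_iff_of_nonneg_ae hnn hint).1 h0
  filter_upwards [h] with U hU
  simpa [mul_self_eq_zero] using hU

/-- **A raw vacuum is a non-zero multiple of the Perron–Frobenius ground state.**  If `φ` is physical, `l2`-normalised and an exact
pointwise top eigenfunction (`K_β φ = λ₀ φ`), and `Ω > 0` is a physical normalised exact top eigenfunction with Jentzsch's gap `θ < λ₀` on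
physical `ψ ⊥ Ω`, then `φ = a·Ω` EVERYWHERE with `a = ⟨φ, Ω⟩ ≠ 0`: the part `ψ = φ − aΩ ⊥ Ω` is again an exact `λ₀`-eigenfunction, so
`λ₀‖ψ‖² = ⟨ψ, K_βψ⟩ ≤ θ‖ψ‖²` forces `ψ = 0` a.e., and the pointwise eigen-equation `φ = λ₀⁻¹K_βφ = λ₀⁻¹K_β(aΩ) = aΩ` holds everywhere.
[cite: ReedSimonIV1978, Thm XIII.43 and Thm XIII.44] -/
theorem rawVacuum_eq_smul_of_gap (β : ℝ) {φ Ω : GaugeConfig 3 L SU2 → ℝ} (hφ : IsPhys φ)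
    (heig : transferApply β φ = topValue su2Rep L β • φ) (hΩ : IsPhys Ω) (hΩ1 : l2 Ω Ω = 1)
    (heigΩ : transferApply β Ω = topValue su2Rep L β • Ω) {θ : ℝ} (hθ : θ < topValue su2Rep L β)
    (hgap : ∀ ψ : GaugeConfig 3 L SU2 → ℝ, IsPhys ψ → l2 ψ Ω = 0 → qform su2Rep β ψ ψ ≤ θ * l2 ψ ψ) :
    ∀ U, φ U = l2 φ Ω * Ω U := by
  set lam0 : ℝ := topValue su2Rep L β with hlam0
  have hlam0pos : 0 < lam0 := topValue_su2Rep_pos L β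
  set a : ℝ := l2 φ Ω with ha
  -- the orthogonal part `ψ = φ + (−a)•Ω`
  set ψ : GaugeConfig 3 L SU2 → ℝ := φ + (-a) • Ω with hψdef
  have hψ : IsPhys ψ := hφ.add (hΩ.smul (-a))
  have hperp : l2 ψ Ω = 0 := by
    rw [hψdef, l2_add_left hφ (hΩ.smul (-a)) hΩ, l2_smul_left, hΩ1]
    ring
  have heigψ : transferApply β ψ = lam0 • ψ := by
    rw [hψdef, transferApply_add β hφ (hΩ.smul (-a)), transferApply_smul, heig, heigΩ]
    funext U
    simp only [Pi.add_apply, Pi.smul_apply, smul_eq_mul]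
    ring
  have hq : qform su2Rep β ψ ψ = lam0 * l2 ψ ψ := by
    rw [qform_eq_l2_transferApply, heigψ, l2_comm, l2_smul_left, l2_comm]
  have hle : lam0 * l2 ψ ψ ≤ θ * l2 ψ ψ := hq ▸ hgap ψ hψ hperp
  have hnn : 0 ≤ l2 ψ ψ := l2_self_nonneg _
  have hzero : l2 ψ ψ = 0 := by nlinarith
  -- `ψ = 0` a.e., so `φ = a•Ω` a.e., so `K_β φ = K_β (a•Ω)` everywhere
  have hae : φ =ᵐ[configMeasure SU2 L] a • Ω := by
    filter_upwards [ae_eq_zero_of_l2_self_eq_zero hψ hzero] with U hU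
    have hU' : φ U + -a * Ω U = 0 := by simpa [hψdef] using hU
    rw [Pi.smul_apply, smul_eq_mul]
    linarith
  have hK : transferApply β φ = a • transferApply β Ω := by
    rw [transferApply_congr_ae hae, transferApply_smul]
  intro U
  have h1 : lam0 * φ U = a * (lam0 * Ω U) := by
    have h := congrArg (fun f => f U) hK
    simp only [heig, heigΩ, Pi.smul_apply, smul_eq_mul] at h
    exact h
  have h2 : lam0 * (φ U - a * Ω U) = 0 := by rw [mul_sub, h1]; ring
  rcases mul_eq_zero.mp h2 with h | h
  · exact absurd h hlam0pos.ne'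
  · exact sub_eq_zero.mp h

/-- **A raw vacuum is uniformly bounded away from zero in absolute value**: if `φ` is physical, `‖φ‖² = 1` and `K_β φ = λ₀ φ` pointwise
(`λ₀ = levelValue su2Rep L β 0`), then `c ≤ |φ U|` for some `c > 0` and all `U` (indeed `φ = ±Ω`, `Ω ≥ c > 0` the Perron–Frobenius ground
state of `PhysL2.exists_groundState`).  Every `L ≥ 1`, every real `β`. [cite: ReedSimonIV1978, Thm XIII.43 and Thm XIII.44] -/
theorem exists_pos_le_abs_rawVacuum (β : ℝ) {φ : GaugeConfig 3 L SU2 → ℝ} (hφ : IsPhys φ) (hφ1 : l2 φ φ = 1)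
    (heig : transferApply β φ = levelValue su2Rep L β 0 • φ) : ∃ c : ℝ, 0 < c ∧ ∀ U, c ≤ |φ U| := by
  obtain ⟨Ω, θ, c, hΩ, hc, hcle, hn, heigΩ, -, hθ, hgap⟩ := PhysL2.exists_groundState (L := L) β
  rw [levelValue_zero] at heig
  have hmul := rawVacuum_eq_smul_of_gap β hφ heig hΩ hn heigΩ hθ hgap
  set a : ℝ := l2 φ Ω with ha
  have ha0 : a ≠ 0 := by
    intro h0
    have hφ0 : φ = fun _ => (0 : ℝ) := funext fun U => by rw [hmul U, h0, zero_mul]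
    have : l2 φ φ = 0 := by rw [hφ0]; simp [l2]
    rw [hφ1] at this
    exact one_ne_zero this
  refine ⟨|a| * c, mul_pos (abs_pos.mpr ha0) hc, fun U => ?_⟩
  rw [hmul U, abs_mul]
  exact mul_le_mul_of_nonneg_left ((hcle U).trans (le_abs_self _)) (abs_nonneg _)

/-- A raw vacuum vanishes nowhere. [cite: ReedSimonIV1978, Thm XIII.43 and Thm XIII.44] -/
theorem rawVacuum_ne_zero (β : ℝ) {φ : GaugeConfig 3 L SU2 → ℝ} (hφ : IsPhys φ) (hφ1 : l2 φ φ = 1)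
    (heig : transferApply β φ = levelValue su2Rep L β 0 • φ) (U : GaugeConfig 3 L SU2) : φ U ≠ 0 := by
  obtain ⟨c, hc, hcle⟩ := exists_pos_le_abs_rawVacuum β hφ hφ1 heig
  exact abs_pos.mp (hc.trans_le (hcle U))

end RawVacuum

/-! ## §2 Continuity of transfer images, exact eigenfunctions, eigen-ratios, flowed lifts and insertions -/

section Continuity

variable {L : ℕ} [NeZero L]

/-- `K_β f` is a continuous function for every physical `f` (continuous bounded kernel on a compact space, dominated convergence —
the tree's `continuous_transferApply_coe` through the `L²` class of `f`). [folklore] -/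
theorem continuous_transferApply (β : ℝ) {f : GaugeConfig 3 L SU2 → ℝ} (hf : IsPhys f) :
    Continuous (transferApply (L := L) β f) := by
  set Φ : physSubmodule L := ⟨f, hf⟩ with hΦ
  have hae : f =ᵐ[configMeasure SU2 L] (toL2 Φ : GaugeConfig 3 L SU2 → ℝ) := (coeFn_toL2 Φ).symm
  rw [transferApply_congr_ae (β := β) hae]
  exact continuous_transferApply_coe (L := L) β (toL2 Φ)

/-- An exact pointwise eigenfunction `K_β f = μ f` with `μ ≠ 0` of a physical `f` is continuous (`f = μ⁻¹ K_β f`). [folklore] -/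
theorem continuous_of_eigen (β : ℝ) {f : GaugeConfig 3 L SU2 → ℝ} (hf : IsPhys f) {μ : ℝ} (hμ : μ ≠ 0)
    (heig : transferApply β f = μ • f) : Continuous f := by
  have h : f = μ⁻¹ • transferApply β f := by
    rw [heig, smul_smul, inv_mul_cancel₀ hμ, one_smul]
  rw [h]
  exact (continuous_transferApply β hf).const_smul _

/-- A one-site (or any-size) EIGEN-RATIO `g` — `g·ω` an exact eigenfunction with eigenvalue `μ ≠ 0`, `ω ≥ c > 0` an exact eigenfunction with
eigenvalue `μ₀ ≠ 0` — is continuous (`g = (g·ω)/ω`). [folklore] -/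
theorem continuous_eigenRatio (B : ℝ) {ω g : GaugeConfig 3 L SU2 → ℝ} (hω : IsPhys ω) (hωpos : ∃ c : ℝ, 0 < c ∧ ∀ V, c ≤ ω V)
    {μ₀ : ℝ} (hμ₀ : μ₀ ≠ 0) (hKω : transferApply B ω = μ₀ • ω) (hg : IsPhys g) {μ : ℝ} (hμ : μ ≠ 0)
    (hKg : transferApply B (g * ω) = μ • (g * ω)) : Continuous g := by
  obtain ⟨c, hc, hcle⟩ := hωpos
  have hωne : ∀ V, ω V ≠ 0 := fun V => (hc.trans_le (hcle V)).ne'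
  have hcontω : Continuous ω := continuous_of_eigen B hω hμ₀ hKω
  have hcontgω : Continuous (g * ω) := continuous_of_eigen B (OpPlat.isPhys_mul hg hω) hμ hKg
  have h : g = fun V => (g * ω) V / ω V := funext fun V => by
    rw [Pi.mul_apply, mul_div_cancel_right₀ _ (hωne V)]
  rw [h]
  exact hcontgω.div hcontω hωne

/-- The flowed Polyakov lift `flowLiftAt x₀ t f` of a continuous one-site function is continuous
(`continuous_wilsonFlow`, `continuous_polyakovSite`). [cite: Luscher2010, §2] -/
theorem continuous_flowLiftAt (x₀ : Site 3 L) (t : ℝ) {f : GaugeConfig 3 1 SU2 → ℝ} (hf : Continuous f) :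
    Continuous (flowLiftAt (L := L) x₀ t f) := by
  show Continuous fun U : GaugeConfig 3 L SU2 => f (polyakovSite x₀ (wilsonFlow t U))
  exact hf.comp ((continuous_polyakovSite x₀).comp (continuous_wilsonFlow t))

/-- The vacuum-subtracted insertion `OpPlat.ins φ O = (O − ⟨φ, Oφ⟩)·φ` is continuous for continuous `φ`, `O`. [folklore] -/
theorem continuous_ins {φ O : GaugeConfig 3 L SU2 → ℝ} (hφ : Continuous φ) (hO : Continuous O) :
    Continuous (OpPlat.ins φ O) := by
  unfold OpPlat.ins
  exact (hO.sub continuous_const).mul hφ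

end Continuity

/-! ## §3 Every one-site configuration is a (flowed) Polyakov triple -/

section Surjective

variable {G : Type*} [Group G] {L : ℕ}

/-- Along the axis `k` from `x₀`: the configuration that carries `V` on the links at `x₀` and `1` elsewhere has trivial holonomy on every
stretch of the axis avoiding `x₀`. [folklore] -/
theorem lineHolonomy_single_eq_one [NeZero L] (x₀ : Site 3 L) (V : Fin 3 → G) (k : Fin 3) :
    ∀ (n m : ℕ), 1 ≤ m → m + n ≤ L →
      lineHolonomy (fun e : Edge 3 L => if e.1 = x₀ then V e.2 else 1) k n (x₀ + Pi.single k ((m : ℕ) : ZMod L)) = 1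
  | 0, m, _, _ => by simp [lineHolonomy]
  | n + 1, m, hm, hmn => by
    rw [lineHolonomy]
    have hne : x₀ + Pi.single k ((m : ℕ) : ZMod L) ≠ x₀ := by
      intro h
      have h1 : Pi.single k ((m : ℕ) : ZMod L) = (0 : Site 3 L) := by
        have := congrArg (fun y => y - x₀) h
        simpa using this
      have h2 : ((m : ℕ) : ZMod L) = 0 := by
        have := congrArg (fun y : Site 3 L => y k) h1
        simpa using this
      rw [ZMod.natCast_eq_zero_iff] at h2
      have : L ≤ m := Nat.le_of_dvd (by omega) h2
      omega
    rw [if_neg hne, one_mul]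
    have hshift : (x₀ + Pi.single k ((m : ℕ) : ZMod L)).shift k = x₀ + Pi.single k (((m + 1 : ℕ) : ℕ) : ZMod L) := by
      rw [Site.shift, add_assoc, ← Pi.single_add]
      push_cast
      rfl
    rw [hshift]
    exact lineHolonomy_single_eq_one x₀ V k n (m + 1) (by omega) (by omega)

/-- **`polyakovSite x₀` is surjective**: the fine configuration with `V_k` on the link `(x₀, k)` and `1` on every other link has Polyakov
triple `(V_1, V_2, V_3)` at `x₀`. [folklore] -/
theorem polyakovSite_surjective [NeZero L] (x₀ : Site 3 L) :
    Function.Surjective (polyakovSite x₀ : GaugeConfig 3 L G → GaugeConfig 3 1 G) := by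
  intro W
  -- the one-point torus has a single site
  have hsite : ∀ y : Site 3 1, y = 0 := fun y => Subsingleton.elim _ _
  refine ⟨fun e : Edge 3 L => if e.1 = x₀ then W (0, e.2) else 1, ?_⟩
  funext e
  obtain ⟨y, k⟩ := e
  rw [hsite y]
  show lineHolonomy (fun e : Edge 3 L => if e.1 = x₀ then W (0, e.2) else 1) k L x₀ = W (0, k)
  obtain ⟨n, hn⟩ : ∃ n, L = n + 1 := Nat.exists_eq_succ_of_ne_zero (NeZero.ne L)
  subst hn
  rw [lineHolonomy, if_pos rfl]
  have hshift : x₀.shift k = x₀ + Pi.single k ((1 : ℕ) : ZMod (n + 1)) := by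
    rw [Nat.cast_one]; rfl
  rw [hshift, lineHolonomy_single_eq_one x₀ (fun k => W (0, k)) k n 1 le_rfl (by omega), mul_one]

/-- **The flowed Polyakov triple is surjective too**: the Wilson flow is invertible (`wilsonFlow_neg_wilsonFlow`), so every one-site
configuration is `polyakovSite x₀ (wilsonFlow t U)` for some fine `U`. [cite: Luscher2010, §2] -/
theorem flowedPolyakovSite_surjective [NeZero L] (x₀ : Site 3 L) (t : ℝ) :
    Function.Surjective fun U : GaugeConfig 3 L SU2 => polyakovSite x₀ (wilsonFlow t U) := by
  intro W
  obtain ⟨U₀, hU₀⟩ := polyakovSite_surjective (G := SU2) x₀ W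
  refine ⟨wilsonFlow (-t) U₀, ?_⟩
  have h := wilsonFlow_neg_wilsonFlow (-t) U₀
  rw [neg_neg] at h
  show polyakovSite x₀ (wilsonFlow t (wilsonFlow (-t) U₀)) = W
  rw [h, hU₀]

end Surjective
end Summit.QuantumFields.YangMills.Theorems.FemtoTransferGap.PolyakovLift

end
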